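import Summits.QuantumFields.YangMills.Theorems.FluctuationComparisonRegPrIntLLargeFieldGasInteriorDoor
import Summits.QuantumFields.YangMills.Theorems.FluctuationComparisonRegPrIntLLargeFieldGasCanonicalTransfer
import Summits.QuantumFields.YangMills.Theorems.FluctuationComparisonRegPrIntLWreg
import Summits.QuantumFields.YangMills.Theorems.BalabanUVNodesN08HaarCompatibilityGuardReparamFibre
import HarnessLib

/-!
# THE REGISTERED `LargeFieldFourPtIntCan` FROM THE BARE A.E. GAS IDENTITY — NO CONTINUITY OF ACTIVITIES (G17, px10 lineage, FILE J):
# ★★★ `largeFieldFourPtIntCan_of_aeIntBare` (✓FILE 4's ⟨LFG^{ae}∘⟩ with its continuity row DELETED ⟹ the registry text :588 VERBATIM), over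
# ★★ `fourPt_abs_le_of_ae` (an a.e. identity on an open window + continuity of the TESTED function upgrade an everywhere four-point bound; Haar resampling of the two moved bonds)

Cell `ym3-torus` (HUMAN RULING D-0037: rung R3 = continuum `SU(2)` Yang–Mills on `T³` — NOT `d = 4`, NOT infinite volume, NOT a mass gap, NOT the Clay problem); width seat
`ym3-torus-px10` (gen 19); helper of the crux `stmt-QuantumFields-20520` `UnitScaleTilt.FluctuationComparisonRegPrIntL` (`--supports … --as helper`, NOT a proof of it).
THEOREMS ONLY: 0 `def`, 0 `instance`, 0 `notation`, 0 `sorry`, default heartbeats.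

WHY.  Every typed road to the registered large-field stub carried a CONTINUITY row for the activities on the window ((vc)∕(hc) of the two-gas package, the engine package's
`ContinuousOn (ζ Q′ X ·)`, ✓FILE 4 `canInt_of_aeInt`'s `∀ X, ContinuousOn (w · X) W`): ✓FILE 4 needed it to turn the A.E. gas identity between the honest densities
`heightDensity` into the POINTWISE identity between canonical versions that ✓FILE 2 `largeFieldFourPtIntCan_of_canInt` consumes.  For HOLE activities that row is the one
demand of the typed format that no Bałaban paper prints (UV3-NODE §45.6 (E2): print's 𝐓-operator is never evaluated pointwise).  THIS FILE removes it: the four-point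
statement is about `log ρ − log heightDensityCan^{histGood}`, a function CONTINUOUS on the window for reasons independent of the expansion (`ρ` by hypothesis of the stub,
the canonical small-history density by ✓WREG `windowRegularity`), and an a.e. bound on the connected four-points of a continuous function on an open set of full support is an
everywhere bound (Haar charges open sets).  So the engine may deliver MEASURABLE-or-worse activities: only V-locality, the Kotecký–Preiss majorant rows and the A.E. identity.
* §1 ★`forall_abs_le_of_ae_of_continuousOn` — generic: `W` open, `f` continuous on `W`, `|f| ≤ C` a.e. on `W`, `μ` charging open sets ⟹ `|f| ≤ C` on `W`.
* §2 ★★`fourPt_abs_le_of_ae` — on `GaugeField P 0 SU(2)` with product Haar: `f` continuous on the open `W`, `f = g` a.e. on `W`, and the connected four-point of `g` at every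
  window quadrilateral over the bonds `(b, b′)` bounded by `B` ⟹ the same for `f`.  The four vertices are resampled from `(U, g₁, g₂[, g₃])` by one-bond updates, each measure
  preserving (✓`…N08HaarCompatibilityGuardReparamFibre.measurePreserving_update`), so the a.e. identity pulls back to the parameter space, where §1 applies (`fourPt_abs_le_of_ae_core`).
* §3 ★★★`largeFieldFourPtIntCan_of_aeIntBare : ⟨LFG^{ae,bare}∘⟩ → ⟨LargeFieldFourPtIntCan :588 VERBATIM⟩`, ⟨LFG^{ae,bare}∘⟩ = ✓FILE 4's ⟨LFG^{ae}∘⟩ (ll.294–321) with the line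
  `(∀ X, ContinuousOn (fun U => w U X) …) ∧` DELETED and nothing else touched: per `(J,K)`, ✓`version_rows` reads `log ρ = log heightDensityCan^{univ} − log Z_K` on `W_J^{c}`,
  ✓`gasZ_pos_of_kpGas` + ✓`kpLogRep'` give `log Ξ(w_U) = c′ + Σ act` with ✓`fourPoint_le_of_repNorm` bounding its four-points EVERYWHERE on `W_J^{c}`, the a.e. identity and
  ✓`Node00.canonVersion_ae_eq` identify the two a.e. on `W_J^{c}`, and §2 upgrades (continuity of `ρ` from the stub, of `heightDensityCan^{histGood}` from ✓`windowRegularity`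
  at `γ ≤ γ_W(L,b₀,p₀)` on the larger `θ(b₀)`-window, ✓`T3InteriorExcision.θBal_mul_le`; `γ₁ := min γ₁ (min 1 γ_W)`, `ψ := 4Ψ`).

HONEST — WHAT THIS IS NOT.  A measure-theoretic door; no expansion, no activity constructed; the a.e. gas identity IS the 𝐑-operation's output (XL, OPEN).  It makes the continuity
rows of the typed LF lane REDUNDANT for the registered stub; it does not remove them from ✓FILE E∕I's texts (a re-cut is the LEAD's∕desk's).  `h2P`∕`h2W`, LF-INT∘,
`stub_largeFieldFourPtIntCan`, S2β, the crux 20520 NOT proved; `YM3TorusSU2` NOT proved; finite volume ∕ conditional; the Yang–Mills mass gap (Clay) NOT proved; rung R3 = YM₃ on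
`T³` — NOT `d = 4`, NOT infinite volume, NOT a mass gap.
References: [Balaban1987RG1] CMP 109 (1987) (0.13) p.254, (0.23)–(0.26) pp.256–257; [Balaban1985UV3] CMP 102 (1985) (2) p.256, (41) p.266; [Balaban1989LargeFieldII] CMP 122 (1989)
(1.90) p.388, (1.98)–(1.101) p.390; [Balaban1988Convergent] CMP 119 (1988) §2 (2.18)–(2.27); [KoteckyPreiss1986] CMP 103 (1986) Theorem p.492.
-/

set_option autoImplicit false

noncomputable section

open MeasureTheory Filter Topology Set Function
open scoped ENNReal
open Literature.Probability.LatticeModels (polyInc polymerPartitionFunction)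
open Literature.MathematicalPhysics.QuantumFieldTheory.Balaban1983to89
open Literature.MathematicalPhysics.QuantumFieldTheory.Balaban1983to89.T3ContinuumYM3Torus
open Literature.MathematicalPhysics.QuantumFieldTheory.Balaban1983to89.T3NestedUnitLaws
open Literature.MathematicalPhysics.QuantumFieldTheory.Balaban1983to89.T3UnitLawDensityEML
open Literature.MathematicalPhysics.QuantumFieldTheory.Balaban1983to89.T3UnitScaleTilt
open Literature.MathematicalPhysics.QuantumFieldTheory.Balaban1983to89.T3TiltDescent
open Literature.MathematicalPhysics.QuantumFieldTheory.Balaban1983to89.T3PrintedRegularMinimiser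
open Literature.MathematicalPhysics.QuantumFieldTheory.Balaban1983to89.T3LevelShift
open Literature.MathematicalPhysics.QuantumFieldTheory.Balaban1983to89.Missing
open Literature.MathematicalPhysics.QuantumFieldTheory.Balaban1983to89.T4Continuum
open scoped Literature.MathematicalPhysics.QuantumFieldTheory.Balaban1983to89.T3OrbitAverage
open Summit.QuantumFields.YangMills.Theorems.FluctuationComparisonRegPrIntLWregGlue (heightDensityCan)
open Summit.QuantumFields.YangMills.Theorems.FluctuationComparisonRegPrIntLS2BetaCanonicalCurrency (version_rows)
open Summit.QuantumFields.YangMills.Theorems.FluctuationComparisonRegPrIntLS2BetaKPLogRep (kpLogRep')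
open Summit.QuantumFields.YangMills.Theorems.FluctuationComparisonRegPrIntLLargeFieldGasInteriorDoor (fourPoint_le_of_repNorm)
open Summit.QuantumFields.YangMills.Theorems.FluctuationComparisonRegPrIntLLargeFieldGasCanonicalTransfer (gasZ_pos_of_kpGas)
open Summit.QuantumFields.YangMills.BalabanUVNodes.N08HaarCompatibilityGuardReparamFibre (measurePreserving_update)

namespace Summit.QuantumFields.YangMills.Theorems.FluctuationComparisonRegPrIntLLargeFieldGasFourPtOfAEIdentity

/-! ## §1 An a.e. bound on a continuous function over an open set of full support is an everywhere bound -/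

/-- ★ **A.E. ⟹ EVERYWHERE FOR CONTINUOUS FUNCTIONS ON OPEN SETS** (the measure charges open sets): `f` continuous on the open `W` and `|f| ≤ C` `μ`-a.e. on `W` give
`|f x| ≤ C` for EVERY `x ∈ W` — the exceptional set is open, hence empty. [cite: Balaban1987RG1, (0.13) p.254 (bookkeeping)] -/
theorem forall_abs_le_of_ae_of_continuousOn {X : Type*} [TopologicalSpace X] [MeasurableSpace X] {μ : Measure X} [μ.IsOpenPosMeasure]
    {W : Set X} (hW : IsOpen W) {f : X → ℝ} (hf : ContinuousOn f W) {C : ℝ} (h : ∀ᵐ x ∂μ, x ∈ W → |f x| ≤ C) :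
    ∀ x ∈ W, |f x| ≤ C := by
  intro x hxW
  by_contra hx
  have hx' : C < |f x| := not_le.mp hx
  have hS : IsOpen (W ∩ (fun y => |f y|) ⁻¹' Ioi C) := (continuous_abs.comp_continuousOn hf).isOpen_inter_preimage hW isOpen_Ioi
  have hpos : 0 < μ (W ∩ (fun y => |f y|) ⁻¹' Ioi C) := hS.measure_pos μ ⟨x, hxW, hx'⟩
  have hnull : μ (W ∩ (fun y => |f y|) ⁻¹' Ioi C) = 0 := by
    rw [ae_iff] at h
    refine measure_mono_null (fun y hy => ?_) h
    exact fun himp => absurd (himp hy.1) (not_le.mpr (show C < |f y| from hy.2))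
  exact hpos.ne' hnull

/-! ## §2 Connected four-points: a.e. identity + continuity of the tested function ⟹ the everywhere bound -/

section FourPt

/-- **ABSTRACT FOUR-VERTEX UPGRADE**: four continuous, quasi-measure-preserving vertex maps from a parameter space whose measure charges open sets; `f` continuous on the open
`W`, `f = g` a.e. on `W`, and the connected four-point of `g` bounded by `B` wherever the four vertices lie in `W` ⟹ the same bound for `f`. [cite: Balaban1987RG1, (0.23)-(0.26) pp.256-257 (bookkeeping)] -/
theorem fourPt_abs_le_of_ae_core {Ω X : Type*} [TopologicalSpace Ω] [MeasurableSpace Ω] {Pm : Measure Ω} [Pm.IsOpenPosMeasure]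
    [TopologicalSpace X] [MeasurableSpace X] {μ : Measure X} (v₀ v₁ v₂ v₃ : Ω → X)
    (hc₀ : Continuous v₀) (hc₁ : Continuous v₁) (hc₂ : Continuous v₂) (hc₃ : Continuous v₃)
    (hm₀ : Measure.QuasiMeasurePreserving v₀ Pm μ) (hm₁ : Measure.QuasiMeasurePreserving v₁ Pm μ)
    (hm₂ : Measure.QuasiMeasurePreserving v₂ Pm μ) (hm₃ : Measure.QuasiMeasurePreserving v₃ Pm μ)
    {W : Set X} (hW : IsOpen W) {f g : X → ℝ} (hf : ContinuousOn f W) (hfg : ∀ᵐ x ∂μ, x ∈ W → f x = g x) {B : ℝ}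
    (hg : ∀ ω, v₀ ω ∈ W → v₁ ω ∈ W → v₂ ω ∈ W → v₃ ω ∈ W → |(g (v₀ ω) - g (v₁ ω)) - (g (v₂ ω) - g (v₃ ω))| ≤ B) :
    ∀ ω, v₀ ω ∈ W → v₁ ω ∈ W → v₂ ω ∈ W → v₃ ω ∈ W → |(f (v₀ ω) - f (v₁ ω)) - (f (v₂ ω) - f (v₃ ω))| ≤ B := by
  -- the open parameter window and the continuous four-point there
  set O : Set Ω := v₀ ⁻¹' W ∩ v₁ ⁻¹' W ∩ v₂ ⁻¹' W ∩ v₃ ⁻¹' W with hO_def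
  have hO : IsOpen O := (((hW.preimage hc₀).inter (hW.preimage hc₁)).inter (hW.preimage hc₂)).inter (hW.preimage hc₃)
  have hfv : ∀ {v : Ω → X}, Continuous v → ContinuousOn (fun ω => f (v ω)) (v ⁻¹' W) := fun hv =>
    hf.comp hv.continuousOn fun ω hω => hω
  have hF : ContinuousOn (fun ω => (f (v₀ ω) - f (v₁ ω)) - (f (v₂ ω) - f (v₃ ω))) O :=
    (((hfv hc₀).mono fun ω hω => hω.1.1.1).sub ((hfv hc₁).mono fun ω hω => hω.1.1.2)).sub
      (((hfv hc₂).mono fun ω hω => hω.1.2).sub ((hfv hc₃).mono fun ω hω => hω.2))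
  -- the a.e. identity pulled back along the four vertex maps
  have key : ∀ᵐ ω ∂Pm, ω ∈ O → |(f (v₀ ω) - f (v₁ ω)) - (f (v₂ ω) - f (v₃ ω))| ≤ B := by
    filter_upwards [hm₀.ae hfg, hm₁.ae hfg, hm₂.ae hfg, hm₃.ae hfg] with ω h₀ h₁ h₂ h₃ hω
    rw [h₀ hω.1.1.1, h₁ hω.1.1.2, h₂ hω.1.2, h₃ hω.2]
    exact hg ω hω.1.1.1 hω.1.1.2 hω.1.2 hω.2
  intro ω h₀ h₁ h₂ h₃
  exact forall_abs_le_of_ae_of_continuousOn hO hF key ω ⟨⟨⟨h₀, h₁⟩, h₂⟩, h₃⟩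

variable {P : Params}

/-- Haar on `SU(2)` charges open sets (Mathlib's `haarMeasure` under the tree's `HaarData`). [cite: Balaban1985Averaging, (10) p.19 (bookkeeping)] -/
theorem isOpenPosMeasure_haar_SU2 : (HaarData.haar : Measure (Matrix.specialUnitaryGroup (Fin 2) ℂ)).IsOpenPosMeasure := by
  show (Literature.MathematicalPhysics.QuantumFieldTheory.haarProbability (Matrix.specialUnitaryGroup (Fin 2) ℂ)).IsOpenPosMeasure
  unfold Literature.MathematicalPhysics.QuantumFieldTheory.haarProbability; infer_instance

/-- Resampling the bond `b` of `U` by a fresh Haar variable read off a product through a measure-preserving coordinate `π` preserves product Haar. [folklore] -/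
theorem measurePreserving_update_of {Y : Type*} [MeasurableSpace Y] {ν : Measure Y} [SFinite ν] (b : PBond P 0)
    {π : Y → Matrix.specialUnitaryGroup (Fin 2) ℂ} (hπ : MeasurePreserving π ν (HaarData.haar : Measure (Matrix.specialUnitaryGroup (Fin 2) ℂ))) :
    MeasurePreserving (fun p : GaugeField P 0 (Matrix.specialUnitaryGroup (Fin 2) ℂ) × Y => update p.1 b (π p.2))
      ((fieldMeasure P 0 (Matrix.specialUnitaryGroup (Fin 2) ℂ)).prod ν) (fieldMeasure P 0 (Matrix.specialUnitaryGroup (Fin 2) ℂ)) := by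
  classical
  haveI := HaarData.isProb (G := Matrix.specialUnitaryGroup (Fin 2) ℂ)
  exact (measurePreserving_update (ι := PBond P 0) (HaarData.haar : Measure (Matrix.specialUnitaryGroup (Fin 2) ℂ)) b).comp
    ((MeasurePreserving.id (fieldMeasure P 0 (Matrix.specialUnitaryGroup (Fin 2) ℂ))).prod hπ)

/-- Resampling `b` by the first and then `b′` by the second of two fresh Haar variables preserves product Haar. [folklore] -/
theorem measurePreserving_update_update (b b' : PBond P 0) :
    MeasurePreserving (fun p : GaugeField P 0 (Matrix.specialUnitaryGroup (Fin 2) ℂ) × ((Matrix.specialUnitaryGroup (Fin 2) ℂ) × (Matrix.specialUnitaryGroup (Fin 2) ℂ)) =>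
        update (update p.1 b p.2.1) b' p.2.2)
      ((fieldMeasure P 0 (Matrix.specialUnitaryGroup (Fin 2) ℂ)).prod ((HaarData.haar : Measure (Matrix.specialUnitaryGroup (Fin 2) ℂ)).prod HaarData.haar))
      (fieldMeasure P 0 (Matrix.specialUnitaryGroup (Fin 2) ℂ)) := by
  classical
  haveI := HaarData.isProb (G := Matrix.specialUnitaryGroup (Fin 2) ℂ)
  -- `(U, (g₁, g₂)) ↦ ((U, g₁), g₂) ↦ (U[b ↦ g₁], g₂) ↦ U[b ↦ g₁][b′ ↦ g₂]`
  have hassoc := (measurePreserving_prodAssoc (fieldMeasure P 0 (Matrix.specialUnitaryGroup (Fin 2) ℂ))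
    (HaarData.haar : Measure (Matrix.specialUnitaryGroup (Fin 2) ℂ)) (HaarData.haar : Measure (Matrix.specialUnitaryGroup (Fin 2) ℂ))).symm
    MeasurableEquiv.prodAssoc
  have hstep := ((measurePreserving_update (ι := PBond P 0) (HaarData.haar : Measure (Matrix.specialUnitaryGroup (Fin 2) ℂ)) b).prod
    (MeasurePreserving.id (HaarData.haar : Measure (Matrix.specialUnitaryGroup (Fin 2) ℂ)))).comp hassoc
  exact (measurePreserving_update (ι := PBond P 0) (HaarData.haar : Measure (Matrix.specialUnitaryGroup (Fin 2) ℂ)) b').comp hstep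

open Classical in
/-- ★★ **A.E. IDENTITY + CONTINUITY OF THE TESTED FUNCTION ⟹ THE EVERYWHERE FOUR-POINT BOUND** on `SU(2)`-configurations: `W` open, `f` continuous on `W`, `f = g` a.e. on `W`,
and `|Δ_bΔ_{b′} g| ≤ B` at every window quadrilateral over `(b, b′)` ⟹ `|Δ_bΔ_{b′} f| ≤ B` at every window quadrilateral.  Vertices are resampled from `(U, g₁, g₂)`
(`b ≠ b′`: `U, U[b↦g₁], U[b′↦g₂], U[b↦g₁][b′↦g₂]`) or `(U, g₁, g₂, g₃)` (`b = b′`: three one-bond updates), each map measure preserving; §1 on the parameter space.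
[cite: Balaban1987RG1, (0.23)-(0.26) pp.256-257 (bookkeeping)] -/
theorem fourPt_abs_le_of_ae {W : Set (GaugeField P 0 (Matrix.specialUnitaryGroup (Fin 2) ℂ))} (hW : IsOpen W)
    {f g : GaugeField P 0 (Matrix.specialUnitaryGroup (Fin 2) ℂ) → ℝ} (hf : ContinuousOn f W)
    (hfg : ∀ᵐ U ∂fieldMeasure P 0 (Matrix.specialUnitaryGroup (Fin 2) ℂ), U ∈ W → f U = g U) (b b' : PBond P 0) {B : ℝ}
    (hg : ∀ (U V Y Z : GaugeField P 0 (Matrix.specialUnitaryGroup (Fin 2) ℂ)), U ∈ W → V ∈ W → Y ∈ W → Z ∈ W →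
      (∀ e, e ≠ b → U e = V e) → (∀ e, e ≠ b' → U e = Y e) → (∀ e, e ≠ b' → V e = Z e) → (∀ e, e ≠ b → Y e = Z e) →
      |(g U - g V) - (g Y - g Z)| ≤ B) :
    ∀ (U V Y Z : GaugeField P 0 (Matrix.specialUnitaryGroup (Fin 2) ℂ)), U ∈ W → V ∈ W → Y ∈ W → Z ∈ W →
      (∀ e, e ≠ b → U e = V e) → (∀ e, e ≠ b' → U e = Y e) → (∀ e, e ≠ b' → V e = Z e) → (∀ e, e ≠ b → Y e = Z e) →
      |(f U - f V) - (f Y - f Z)| ≤ B := by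
  haveI hFM : (fieldMeasure P 0 (Matrix.specialUnitaryGroup (Fin 2) ℂ)).IsOpenPosMeasure :=
    B12ContinuousTransportInvariance.isOpenPosMeasure_fieldMeasure_SU (N := 2) P 0
  haveI := isOpenPosMeasure_haar_SU2
  haveI := HaarData.isProb (G := Matrix.specialUnitaryGroup (Fin 2) ℂ)
  -- the parameter measures charge open sets (products of open-positive measures)
  haveI h2 : ((HaarData.haar : Measure (Matrix.specialUnitaryGroup (Fin 2) ℂ)).prod (HaarData.haar : Measure (Matrix.specialUnitaryGroup (Fin 2) ℂ))).IsOpenPosMeasure := Measure.prod.instIsOpenPosMeasure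
  haveI h3 : ((HaarData.haar : Measure (Matrix.specialUnitaryGroup (Fin 2) ℂ)).prod ((HaarData.haar : Measure (Matrix.specialUnitaryGroup (Fin 2) ℂ)).prod (HaarData.haar : Measure (Matrix.specialUnitaryGroup (Fin 2) ℂ)))).IsOpenPosMeasure := Measure.prod.instIsOpenPosMeasure
  haveI : ((fieldMeasure P 0 (Matrix.specialUnitaryGroup (Fin 2) ℂ)).prod ((HaarData.haar : Measure (Matrix.specialUnitaryGroup (Fin 2) ℂ)).prod (HaarData.haar : Measure (Matrix.specialUnitaryGroup (Fin 2) ℂ)))).IsOpenPosMeasure :=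
    @Measure.prod.instIsOpenPosMeasure _ _ _ _ _ _ hFM _ _ h2 _
  haveI : ((fieldMeasure P 0 (Matrix.specialUnitaryGroup (Fin 2) ℂ)).prod ((HaarData.haar : Measure (Matrix.specialUnitaryGroup (Fin 2) ℂ)).prod ((HaarData.haar : Measure (Matrix.specialUnitaryGroup (Fin 2) ℂ)).prod (HaarData.haar : Measure (Matrix.specialUnitaryGroup (Fin 2) ℂ))))).IsOpenPosMeasure :=
    @Measure.prod.instIsOpenPosMeasure _ _ _ _ _ _ hFM _ _ h3 _
  intro U V Y Z hU hV hY hZ hUV hUY hVZ hYZ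
  -- one-bond update identities from the window moves
  have eV : V = update U b (V b) := by
    funext e; by_cases he : e = b
    · subst he; simp
    · rw [update_of_ne he]; exact (hUV e he).symm
  have eY : Y = update U b' (Y b') := by
    funext e; by_cases he : e = b'
    · subst he; simp
    · rw [update_of_ne he]; exact (hUY e he).symm
  -- the coordinate maps of the fresh Haar variables
  have hπ₁ : MeasurePreserving (fun q : (Matrix.specialUnitaryGroup (Fin 2) ℂ) × ((Matrix.specialUnitaryGroup (Fin 2) ℂ) × (Matrix.specialUnitaryGroup (Fin 2) ℂ)) => q.1)
      ((HaarData.haar : Measure (Matrix.specialUnitaryGroup (Fin 2) ℂ)).prod ((HaarData.haar : Measure (Matrix.specialUnitaryGroup (Fin 2) ℂ)).prod (HaarData.haar : Measure (Matrix.specialUnitaryGroup (Fin 2) ℂ)))) (HaarData.haar : Measure (Matrix.specialUnitaryGroup (Fin 2) ℂ)) := measurePreserving_fst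
  have hπ₂ : MeasurePreserving (fun q : (Matrix.specialUnitaryGroup (Fin 2) ℂ) × ((Matrix.specialUnitaryGroup (Fin 2) ℂ) × (Matrix.specialUnitaryGroup (Fin 2) ℂ)) => q.2.1)
      ((HaarData.haar : Measure (Matrix.specialUnitaryGroup (Fin 2) ℂ)).prod ((HaarData.haar : Measure (Matrix.specialUnitaryGroup (Fin 2) ℂ)).prod (HaarData.haar : Measure (Matrix.specialUnitaryGroup (Fin 2) ℂ)))) (HaarData.haar : Measure (Matrix.specialUnitaryGroup (Fin 2) ℂ)) := measurePreserving_fst.comp measurePreserving_snd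
  have hπ₃ : MeasurePreserving (fun q : (Matrix.specialUnitaryGroup (Fin 2) ℂ) × ((Matrix.specialUnitaryGroup (Fin 2) ℂ) × (Matrix.specialUnitaryGroup (Fin 2) ℂ)) => q.2.2)
      ((HaarData.haar : Measure (Matrix.specialUnitaryGroup (Fin 2) ℂ)).prod ((HaarData.haar : Measure (Matrix.specialUnitaryGroup (Fin 2) ℂ)).prod (HaarData.haar : Measure (Matrix.specialUnitaryGroup (Fin 2) ℂ)))) (HaarData.haar : Measure (Matrix.specialUnitaryGroup (Fin 2) ℂ)) := measurePreserving_snd.comp measurePreserving_snd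
  by_cases hbb : b = b'
  · -- `b = b′`: three independent one-bond updates of `U`
    subst hbb
    have eZ : Z = update U b (Z b) := by
      funext e; by_cases he : e = b
      · subst he; simp
      · rw [update_of_ne he]; exact ((hUV e he).trans (hVZ e he)).symm
    have key := fourPt_abs_le_of_ae_core (Pm := (fieldMeasure P 0 (Matrix.specialUnitaryGroup (Fin 2) ℂ)).prod ((HaarData.haar : Measure (Matrix.specialUnitaryGroup (Fin 2) ℂ)).prod ((HaarData.haar : Measure (Matrix.specialUnitaryGroup (Fin 2) ℂ)).prod (HaarData.haar : Measure (Matrix.specialUnitaryGroup (Fin 2) ℂ)))))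
      (μ := fieldMeasure P 0 (Matrix.specialUnitaryGroup (Fin 2) ℂ))
      (fun p => p.1) (fun p => update p.1 b p.2.1) (fun p => update p.1 b p.2.2.1) (fun p => update p.1 b p.2.2.2)
      continuous_fst (continuous_fst.update b (continuous_fst.comp continuous_snd))
      (continuous_fst.update b ((continuous_fst.comp continuous_snd).comp continuous_snd))
      (continuous_fst.update b ((continuous_snd.comp continuous_snd).comp continuous_snd))
      (measurePreserving_fst (μ := fieldMeasure P 0 (Matrix.specialUnitaryGroup (Fin 2) ℂ)) (ν := (HaarData.haar : Measure (Matrix.specialUnitaryGroup (Fin 2) ℂ)).prod ((HaarData.haar : Measure (Matrix.specialUnitaryGroup (Fin 2) ℂ)).prod (HaarData.haar : Measure (Matrix.specialUnitaryGroup (Fin 2) ℂ))))).quasiMeasurePreserving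
      (measurePreserving_update_of b hπ₁).quasiMeasurePreserving (measurePreserving_update_of b hπ₂).quasiMeasurePreserving
      (measurePreserving_update_of b hπ₃).quasiMeasurePreserving hW hf hfg (B := B)
      (fun ω h₀ h₁ h₂ h₃ => hg _ _ _ _ h₀ h₁ h₂ h₃ (fun e he => by simp [update_of_ne he]) (fun e he => by simp [update_of_ne he])
        (fun e he => by simp [update_of_ne he]) (fun e he => by simp [update_of_ne he]))
      (U, (V b, (Y b, Z b))) hU (eV ▸ hV) (eY ▸ hY) (eZ ▸ hZ)
    rw [eV, eY, eZ]
    exact key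
  · -- `b ≠ b′`: two fresh variables, the fourth vertex doubly updated
    have eZ : Z = update (update U b (V b)) b' (Y b') := by
      funext e; by_cases he : e = b'
      · subst he; simp [hYZ e (Ne.symm hbb)]
      · rw [update_of_ne he, ← eV]; exact (hVZ e he).symm
    have hρ₁ : MeasurePreserving (fun q : (Matrix.specialUnitaryGroup (Fin 2) ℂ) × (Matrix.specialUnitaryGroup (Fin 2) ℂ) => q.1) ((HaarData.haar : Measure (Matrix.specialUnitaryGroup (Fin 2) ℂ)).prod (HaarData.haar : Measure (Matrix.specialUnitaryGroup (Fin 2) ℂ))) (HaarData.haar : Measure (Matrix.specialUnitaryGroup (Fin 2) ℂ)) :=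
      measurePreserving_fst
    have hρ₂ : MeasurePreserving (fun q : (Matrix.specialUnitaryGroup (Fin 2) ℂ) × (Matrix.specialUnitaryGroup (Fin 2) ℂ) => q.2) ((HaarData.haar : Measure (Matrix.specialUnitaryGroup (Fin 2) ℂ)).prod (HaarData.haar : Measure (Matrix.specialUnitaryGroup (Fin 2) ℂ))) (HaarData.haar : Measure (Matrix.specialUnitaryGroup (Fin 2) ℂ)) :=
      measurePreserving_snd
    have key := fourPt_abs_le_of_ae_core (Pm := (fieldMeasure P 0 (Matrix.specialUnitaryGroup (Fin 2) ℂ)).prod ((HaarData.haar : Measure (Matrix.specialUnitaryGroup (Fin 2) ℂ)).prod (HaarData.haar : Measure (Matrix.specialUnitaryGroup (Fin 2) ℂ))))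
      (μ := fieldMeasure P 0 (Matrix.specialUnitaryGroup (Fin 2) ℂ))
      (fun p => p.1) (fun p => update p.1 b p.2.1) (fun p => update p.1 b' p.2.2) (fun p => update (update p.1 b p.2.1) b' p.2.2)
      continuous_fst (continuous_fst.update b (continuous_fst.comp continuous_snd)) (continuous_fst.update b' (continuous_snd.comp continuous_snd))
      ((continuous_fst.update b (continuous_fst.comp continuous_snd)).update b' (continuous_snd.comp continuous_snd))
      (measurePreserving_fst (μ := fieldMeasure P 0 (Matrix.specialUnitaryGroup (Fin 2) ℂ)) (ν := (HaarData.haar : Measure (Matrix.specialUnitaryGroup (Fin 2) ℂ)).prod (HaarData.haar : Measure (Matrix.specialUnitaryGroup (Fin 2) ℂ)))).quasiMeasurePreserving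
      (measurePreserving_update_of b hρ₁).quasiMeasurePreserving (measurePreserving_update_of b' hρ₂).quasiMeasurePreserving
      (measurePreserving_update_update b b').quasiMeasurePreserving hW hf hfg (B := B)
      (fun ω h₀ h₁ h₂ h₃ => hg _ _ _ _ h₀ h₁ h₂ h₃ (fun e he => by simp [update_of_ne he]) (fun e he => by simp [update_of_ne he])
        (fun e he => by simp [update_of_ne he]) (fun e he => by
          by_cases he' : e = b'
          · subst he'; simp
          · simp [update_of_ne he, update_of_ne he']))
      (U, (V b, Y b')) hU (eV ▸ hV) (eY ▸ hY) (eZ ▸ hZ)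
    rw [eV, eY, eZ]
    exact key

end FourPt

/-! ## §3 The registered stub from the BARE a.e. gas identity (no continuity of activities) -/

section Door

open Classical in
/-- ★★★ **THE REGISTERED `LargeFieldFourPtIntCan` (registry v11.4 :588, VERBATIM, δ-unfolded) FROM THE BARE A.E. GAS IDENTITY ⟨LFG^{ae,bare}∘⟩** = ✓FILE 4's ⟨LFG^{ae}∘⟩ with
its continuity row deleted: same prefix and rows (r1∘)(r2∘)(hgpos∘) as antecedents, the Kotecký–Preiss block, and the identity `heightDensity univ = e^{cst}·heightDensity
histGood·Re Ξ(w)` only `dU_J`-A.E. on `W_J^{c}` — activities need be neither continuous nor measurable.  `γ₁ := min γ₁ (min 1 γ_WREG)`, `ψ := 4Ψ`.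
[cite: Balaban1987RG1, (0.13) p.254 and (0.23)-(0.26) pp.256-257; Balaban1989LargeFieldII, (1.90) p.388 and (1.98)-(1.101) p.390; Balaban1988Convergent, §2 (2.18)-(2.27)] -/
theorem largeFieldFourPtIntCan_of_aeIntBare
    (h : ∀ (L : ℕ), ∃ c₀ : ℝ, 0 < c₀ ∧ c₀ ≤ 1 ∧ ∀ (c : ℝ), 0 < c → c ≤ c₀ → ∃ pS : ℝ, ∀ (b₀ p₀ : ℝ), 0 < b₀ → pS ≤ p₀ → 0 < p₀ →
      ∃ γ₁ : ℝ, 0 < γ₁ ∧ ∃ κ : ℝ, 0 < κ ∧ ∀ (F : T3Family) (γ : ℝ), F.L = L → 0 < γ → γ ≤ γ₁ →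
        ∃ Ψ : ℕ → ℝ, (∀ J, 0 ≤ Ψ J) ∧ Tendsto (fun J : ℕ => (J : ℝ) * Ψ J) atTop (𝓝 0) ∧
          ∀ (J K : ℕ) (hJK : J ≤ K),
            {U : GaugeField (F.P J) 0 (Matrix.specialUnitaryGroup (Fin 2) ℂ) | PlaqSmall (θBal F.L γ (c * b₀) p₀ J) U} ⊆
              Node00.regSet (fieldMeasure (F.P J) 0 (Matrix.specialUnitaryGroup (Fin 2) ℂ)) (heightDensity F γ hJK Set.univ) →
            (∀ U : GaugeField (F.P J) 0 (Matrix.specialUnitaryGroup (Fin 2) ℂ), PlaqSmall (θBal F.L γ (c * b₀) p₀ J) U →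
                0 < heightDensityCan F γ hJK Set.univ U) →
            (∀ U : GaugeField (F.P J) 0 (Matrix.specialUnitaryGroup (Fin 2) ℂ), PlaqSmall (θBal F.L γ (c * b₀) p₀ J) U →
                0 < heightDensityCan F γ hJK (histGood F ℰp (θBal F.L γ b₀ p₀) K J) U) →
            ∃ (cst : ℝ) (w : GaugeField (F.P J) 0 (Matrix.specialUnitaryGroup (Fin 2) ℂ) → Finset (PBond (F.P J) 0) → ℝ),
              (∃ (wbar a ℓ : Finset (PBond (F.P J) 0) → ℝ),
                (∀ U, w U ∅ = 0) ∧
                (∀ (X : Finset (PBond (F.P J) 0)) (U U' : GaugeField (F.P J) 0 (Matrix.specialUnitaryGroup (Fin 2) ℂ)),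
                  (∀ e ∈ X, U e = U' e) → w U X = w U' X) ∧
                (∀ X, 0 ≤ a X) ∧ (∀ X, 0 ≤ ℓ X) ∧
                (∀ U, U ∈ {U : GaugeField (F.P J) 0 (Matrix.specialUnitaryGroup (Fin 2) ℂ) | PlaqSmall (θBal F.L γ (c * b₀) p₀ J) U} →
                  ∀ X, |w U X| ≤ wbar X) ∧
                (∀ X : Finset (PBond (F.P J) 0), ∀ e ∈ X, ∀ e' ∈ X, (e.src.tdist e'.src : ℝ) ≤ ℓ X) ∧
                (∀ X : Finset (PBond (F.P J) 0), ∑ X' ∈ Finset.univ.filter (fun X' => polyInc X' X),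
                    wbar X' * Real.exp (a X' + κ * ℓ X') ≤ a X) ∧
                (∀ e : PBond (F.P J) 0, a {e} ≤ Ψ J)) ∧
              ∀ᵐ U ∂fieldMeasure (F.P J) 0 (Matrix.specialUnitaryGroup (Fin 2) ℂ), PlaqSmall (θBal F.L γ (c * b₀) p₀ J) U →
                heightDensity F γ hJK Set.univ U = Real.exp cst * heightDensity F γ hJK (histGood F ℰp (θBal F.L γ b₀ p₀) K J) U *
                  (polymerPartitionFunction polyInc (fun X : Finset (PBond (F.P J) 0) => ((w U X : ℝ) : ℂ)) Finset.univ).re) :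

    ∀ (L : ℕ), ∃ c₀ : ℝ, 0 < c₀ ∧ c₀ ≤ 1 ∧ ∀ (c : ℝ), 0 < c → c ≤ c₀ → ∃ pS : ℝ, ∀ (b₀ p₀ : ℝ), 0 < b₀ → pS ≤ p₀ → 0 < p₀ →
      ∃ γ₁ : ℝ, 0 < γ₁ ∧ ∃ κ : ℝ, 0 < κ ∧ ∀ (F : T3Family) (γ : ℝ), F.L = L → 0 < γ → γ ≤ γ₁ →
        ∃ ψ : ℕ → ℝ, (∀ J, 0 ≤ ψ J) ∧ Tendsto (fun J : ℕ => (J : ℝ) * ψ J) atTop (𝓝 0) ∧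
          ∀ (ν : ℕ → (j : ℕ) → Measure (GaugeField (F.P j) 0 (Matrix.specialUnitaryGroup (Fin 2) ℂ))),
            (∀ K, ν K K = T4GenFunBounds.gibbsMeasure (F.P K) ((F.scheme ℰp γ).β K)) →
            (∀ K j, j < K → ν K j = Measure.map (descend F ℰp j) (ν K (j + 1))) →
            ∀ (J K : ℕ) (hJK : J ≤ K) (ρ : GaugeField (F.P J) 0 (Matrix.specialUnitaryGroup (Fin 2) ℂ) → ℝ),
              (∀ U, PlaqSmall (θBal F.L γ (c * b₀) p₀ J) U → 0 < ρ U) →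
              ν K J = (fieldMeasure _ _ _).withDensity (fun U => ENNReal.ofReal (ρ U)) →
              ContinuousOn ρ {U | PlaqSmall (θBal F.L γ (c * b₀) p₀ J) U} →
              (∀ U : GaugeField (F.P J) 0 (Matrix.specialUnitaryGroup (Fin 2) ℂ), PlaqSmall (θBal F.L γ (c * b₀) p₀ J) U →
                  0 < heightDensityCan F γ hJK (histGood F ℰp (θBal F.L γ b₀ p₀) K J) U) →
              ∀ (b b' : PBond (F.P J) 0) (U V W Z : GaugeField (F.P J) 0 (Matrix.specialUnitaryGroup (Fin 2) ℂ)),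
                PlaqSmall (θBal F.L γ (c * b₀) p₀ J) U → PlaqSmall (θBal F.L γ (c * b₀) p₀ J) V →
                PlaqSmall (θBal F.L γ (c * b₀) p₀ J) W → PlaqSmall (θBal F.L γ (c * b₀) p₀ J) Z →
                (∀ e, e ≠ b → U e = V e) → (∀ e, e ≠ b' → U e = W e) → (∀ e, e ≠ b' → V e = Z e) → (∀ e, e ≠ b → W e = Z e) →
                |((fun U => Real.log (ρ U) - Real.log (heightDensityCan F γ hJK (histGood F ℰp (θBal F.L γ b₀ p₀) K J) U)) U -
                    (fun U => Real.log (ρ U) - Real.log (heightDensityCan F γ hJK (histGood F ℰp (θBal F.L γ b₀ p₀) K J) U)) V) -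
                  ((fun U => Real.log (ρ U) - Real.log (heightDensityCan F γ hJK (histGood F ℰp (θBal F.L γ b₀ p₀) K J) U)) W -
                    (fun U => Real.log (ρ U) - Real.log (heightDensityCan F γ hJK (histGood F ℰp (θBal F.L γ b₀ p₀) K J) U)) Z)|
                  ≤ ψ J * Real.exp (-(κ * (b.src.tdist b'.src : ℝ))) := by
  intro L
  obtain ⟨c₀, hc₀, hc₀1, H⟩ := h L
  refine ⟨c₀, hc₀, hc₀1, fun c hc hcc₀ => ?_⟩
  obtain ⟨pS, H⟩ := H c hc hcc₀
  refine ⟨pS, fun b₀ p₀ hb hpS hp => ?_⟩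
  obtain ⟨γ₁, hγ₁, κ, hκ, H⟩ := H b₀ p₀ hb hpS hp
  -- WREG's coupling ceiling at the history profile `b₀`
  obtain ⟨γW, hγW, HW⟩ := Summit.QuantumFields.YangMills.Theorems.FluctuationComparisonRegPrIntLWreg.windowRegularity L b₀ p₀ hb hp
  refine ⟨min γ₁ (min 1 γW), lt_min hγ₁ (lt_min one_pos hγW), κ, hκ, fun F γ hFL hγ hγle => ?_⟩
  have hγ₁' : γ ≤ γ₁ := hγle.trans (min_le_left _ _)
  have hγ1 : γ ≤ 1 := hγle.trans ((min_le_right _ _).trans (min_le_left _ _))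
  have hγW' : γ ≤ γW := hγle.trans ((min_le_right _ _).trans (min_le_right _ _))
  obtain ⟨Ψ, hΨ0, hΨt, H⟩ := H F γ hFL hγ hγ₁'
  refine ⟨fun J => 4 * Ψ J, fun J => by have := hΨ0 J; positivity, ?_, ?_⟩
  · have ht := hΨt.const_mul 4
    rw [mul_zero] at ht
    refine ht.congr' (Eventually.of_forall fun J => ?_)
    show 4 * ((J : ℝ) * Ψ J) = (J : ℝ) * (4 * Ψ J)
    ring
  intro ν hνK hνd J K hJK ρ hρpos hνρ hρc hgpos b b' U V Y Z hU hV hY hZ hUV hUY hVZ hYZ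
  haveI : (fieldMeasure (F.P J) 0 (Matrix.specialUnitaryGroup (Fin 2) ℂ)).IsOpenPosMeasure :=
    B12ContinuousTransportInvariance.isOpenPosMeasure_fieldMeasure_SU (N := 2) (F.P J) 0
  -- the interior window, open, inside the `θ(b₀)`-window
  set Wc : Set (GaugeField (F.P J) 0 (Matrix.specialUnitaryGroup (Fin 2) ℂ)) :=
    {U : GaugeField (F.P J) 0 (Matrix.specialUnitaryGroup (Fin 2) ℂ) | PlaqSmall (θBal F.L γ (c * b₀) p₀ J) U} with hWc
  have hWo : IsOpen Wc := Node00.isOpen_plaqSmall _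
  have hsub : Wc ⊆ {U : GaugeField (F.P J) 0 (Matrix.specialUnitaryGroup (Fin 2) ℂ) | PlaqSmall (θBal F.L γ b₀ p₀ J) U} := fun X hX =>
    T3PrintedMinimiserExistence.plaqSmall_of_le (T3InteriorExcision.θBal_mul_le F.hL.2.le hγ hγ1 hb (hcc₀.trans hc₀1) p₀ J) hX
  -- the version read back on the canonical full density, at thresholds `c·b₀`
  obtain ⟨hR, hP, hlog⟩ := version_rows F (c * b₀) p₀ hJK hγ ν hνK hνd ρ hρpos hνρ hρc
  obtain ⟨cst, w, hgas, hae⟩ := H J K hJK hR hP hgpos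
  set Zp : ℝ := partitionFn (G := Matrix.specialUnitaryGroup (Fin 2) ℂ) (F.P K) ((F.scheme ℰp γ).β K) with hZp
  -- KPL: positivity and the log representation of the gas on the interior window
  have hΞpos := gasZ_pos_of_kpGas Wc (Ψ J) hκ.le w hgas
  obtain ⟨n, supp, len, wt, act, c', hloc, hwt, hdiam, hbd, hcov, hrep⟩ := kpLogRep' Wc κ (Ψ J) hκ.le w hgas
  -- continuity of the tested function on the window: `ρ` by hypothesis, the canonical small-history density by WREG
  have hreg : Wc ⊆ Node00.regSet (fieldMeasure (F.P J) 0 (Matrix.specialUnitaryGroup (Fin 2) ℂ))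
      (heightDensity F γ hJK (histGood F ℰp (θBal F.L γ b₀ p₀) K J)) :=
    hsub.trans (HW F γ hFL hγ hγW' J K hJK γ hγ).1
  haveI : SecondCountableTopology (GaugeField (F.P J) 0 (Matrix.specialUnitaryGroup (Fin 2) ℂ)) := T3OrbitAverage.instSecondCountableGaugeField
  haveI : BorelSpace (GaugeField (F.P J) 0 (Matrix.specialUnitaryGroup (Fin 2) ℂ)) := T3OrbitAverage.instBorelSpaceGaugeField
  have hgc : ContinuousOn (heightDensityCan F γ hJK (histGood F ℰp (θBal F.L γ b₀ p₀) K J)) Wc :=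
    (Node00.continuousOn_canonVersion (μ := fieldMeasure (F.P J) 0 (Matrix.specialUnitaryGroup (Fin 2) ℂ))
      (f := heightDensity F γ hJK (histGood F ℰp (θBal F.L γ b₀ p₀) K J))).mono hreg
  have hfc : ContinuousOn (fun X => Real.log (ρ X) - Real.log (heightDensityCan F γ hJK (histGood F ℰp (θBal F.L γ b₀ p₀) K J) X)) Wc :=
    (hρc.log fun X hX => (hρpos X hX).ne').sub (hgc.log fun X hX => (hgpos X hX).ne')
  -- `f = g` a.e. on the window (`g` = the logged gas plus constants)
  have hcanu : heightDensityCan F γ hJK Set.univ =ᵐ[fieldMeasure (F.P J) 0 (Matrix.specialUnitaryGroup (Fin 2) ℂ)] heightDensity F γ hJK Set.univ :=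
    Node00.canonVersion_ae_eq
  have hcang : heightDensityCan F γ hJK (histGood F ℰp (θBal F.L γ b₀ p₀) K J) =ᵐ[fieldMeasure (F.P J) 0 (Matrix.specialUnitaryGroup (Fin 2) ℂ)]
      heightDensity F γ hJK (histGood F ℰp (θBal F.L γ b₀ p₀) K J) :=
    Node00.canonVersion_ae_eq
  have hfg : ∀ᵐ X ∂fieldMeasure (F.P J) 0 (Matrix.specialUnitaryGroup (Fin 2) ℂ), X ∈ Wc →
      (fun X => Real.log (ρ X) - Real.log (heightDensityCan F γ hJK (histGood F ℰp (θBal F.L γ b₀ p₀) K J) X)) X =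
        (fun X => (cst - Real.log Zp + c') + ∑ i, act i X) X := by
    filter_upwards [hae, hcanu, hcang] with X hX hXu hXg hXW
    have hgX := hgpos X hXW
    have hΞX := hΞpos X hXW
    have hidX : heightDensityCan F γ hJK Set.univ X =
        Real.exp cst * heightDensityCan F γ hJK (histGood F ℰp (θBal F.L γ b₀ p₀) K J) X *
          (polymerPartitionFunction polyInc (fun Y : Finset (PBond (F.P J) 0) => ((w X Y : ℝ) : ℂ)) Finset.univ).re := by
      rw [hXu, hXg]; exact hX hXW
    have hlogu : Real.log (heightDensityCan F γ hJK Set.univ X) =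
        cst + Real.log (heightDensityCan F γ hJK (histGood F ℰp (θBal F.L γ b₀ p₀) K J) X) +
          Real.log ((polymerPartitionFunction polyInc (fun Y : Finset (PBond (F.P J) 0) => ((w X Y : ℝ) : ℂ)) Finset.univ).re) := by
      rw [hidX, Real.log_mul (mul_pos (Real.exp_pos _) hgX).ne' hΞX.ne', Real.log_mul (Real.exp_pos _).ne' hgX.ne', Real.log_exp]
    show Real.log (ρ X) - Real.log (heightDensityCan F γ hJK (histGood F ℰp (θBal F.L γ b₀ p₀) K J) X) = (cst - Real.log Zp + c') + ∑ i, act i X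
    rw [hlog X hXW, hlogu, hrep X hXW]
    ring
  -- the four-points of `g` are bounded everywhere on the window (V-locality of the polymer representation)
  have hgb : ∀ (U V Y Z : GaugeField (F.P J) 0 (Matrix.specialUnitaryGroup (Fin 2) ℂ)), U ∈ Wc → V ∈ Wc → Y ∈ Wc → Z ∈ Wc →
      (∀ e, e ≠ b → U e = V e) → (∀ e, e ≠ b' → U e = Y e) → (∀ e, e ≠ b' → V e = Z e) → (∀ e, e ≠ b → Y e = Z e) →
      |((fun X => (cst - Real.log Zp + c') + ∑ i, act i X) U - (fun X => (cst - Real.log Zp + c') + ∑ i, act i X) V) -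
        ((fun X => (cst - Real.log Zp + c') + ∑ i, act i X) Y - (fun X => (cst - Real.log Zp + c') + ∑ i, act i X) Z)|
        ≤ 4 * Ψ J * Real.exp (-(κ * (b.src.tdist b'.src : ℝ))) :=
    fun U V Y Z hU hV hY hZ hUV hUY hVZ hYZ =>
      fourPoint_le_of_repNorm Wc supp len wt act κ (Ψ J) (cst - Real.log Zp + c') hκ.le hloc hwt hdiam hbd hcov b b' U V Y Z hU hV hY hZ hUV hUY hVZ hYZ
  -- upgrade
  have key := fourPt_abs_le_of_ae hWo hfc hfg b b' hgb U V Y Z hU hV hY hZ hUV hUY hVZ hYZ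
  calc |((fun X => Real.log (ρ X) - Real.log (heightDensityCan F γ hJK (histGood F ℰp (θBal F.L γ b₀ p₀) K J) X)) U -
          (fun X => Real.log (ρ X) - Real.log (heightDensityCan F γ hJK (histGood F ℰp (θBal F.L γ b₀ p₀) K J) X)) V) -
        ((fun X => Real.log (ρ X) - Real.log (heightDensityCan F γ hJK (histGood F ℰp (θBal F.L γ b₀ p₀) K J) X)) Y -
          (fun X => Real.log (ρ X) - Real.log (heightDensityCan F γ hJK (histGood F ℰp (θBal F.L γ b₀ p₀) K J) X)) Z)|
        ≤ 4 * Ψ J * Real.exp (-(κ * (b.src.tdist b'.src : ℝ))) := key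
    _ = (4 * Ψ J) * Real.exp (-(κ * (b.src.tdist b'.src : ℝ))) := by ring

end Door

end Summit.QuantumFields.YangMills.Theorems.FluctuationComparisonRegPrIntLLargeFieldGasFourPtOfAEIdentity

end
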